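import Mathlib
import Summits.NavierStokesRegularity.NavierStokesRegularity.Theorems.FilamentSkeletonRssSkeletonJ1RLiaRefEnvelope
import Summits.NavierStokesRegularity.NavierStokesRegularity.Theorems.FilamentSkeletonRssSkeletonJ1RLiaReference

/-!
# Crux `SkeletonJ1R` (stmt-NavierStokesRegularity-23610) · line `streamline_kantorovich_R` · toward stub F2-d (`LiaDefectDerivBL`, v7), bricks of S4′ / bookkeeping:
# THE GLOBAL CURVATURE CEILING `κm` OF THE LIA REFERENCE and THE REDUCTION OF B1′ TO THE DERIVATIVE LOCAL-INDUCTION ERROR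

Hand `leafhand-ns-filamentskeletonrs-1` (gen 0), `--supports stmt-NavierStokesRegularity-23610 --as helper`.  MODEL rung, NEGATIVE side of the ladder:
calculus for a HYPOTHETICAL filament-type blow-up skeleton; nothing here is a claim about Navier–Stokes regularity; the stub and the crux stay OPEN.

* `IsLiaReference.norm_deriv_deriv_le_ceiling` — the far-zone input `κm` of S3′ (`…LiaSelfDerivEstimate.symmDerivStrand_sub_lia_le`): everywhere
  `‖x_j″σ‖ ≤ |β⁻¹|·(B_d + Q·√3·ℓ)`, `B_d = Σ_{k≠j}|Γγ_k/4π|·2/d`, `Q = ½ + |α|` — the reference is straight where `‖x‖² ≥ 3ℓ²` (`refCutoff_eq_zero`) and on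
  `‖x‖ ≤ √3ℓ` the ambient field is `≤ B_d + Q‖x‖` (`…LiaReference.norm_ambientField_le` with the partner distance `d` of `dist_partner_ge_of_tilt`).
* `norm_perp_selfResidual_le` — the pointwise reduction used by the B1′ bookkeeping: for a unit `T`,
  `‖P⊥_T(A − β•(T×V + K×K))‖ ≤ ‖A − β•T×V‖` (`K×K = 0`, `‖P⊥v‖ ≤ ‖v‖`), so B1′ follows from `ℓ‖c_jȦ_j − β x′×x‴‖ ≤ C(√Γ+|τ|)/√log Γ`.
-/

set_option linter.dupNamespace false -- `NavierStokesRegularity.NavierStokesRegularity` path/namespace repetition is the tree convention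

noncomputable section

namespace Summit.NavierStokesRegularity.NavierStokesRegularity.Theorems.SkeletonJ1RFrame

open Set Function Filter MeasureTheory Real Topology
open Literature.Analysis.FluidPDE
open scoped InnerProductSpace BigOperators

/-! ## §1 The reduction of B1′ -/

/-- `‖P⊥_T(A − β•(T×V + K×K))‖ ≤ ‖A − β•T×V‖` for a unit vector `T` (the self-residual derivative has `x″×x″ = 0`). [folklore] -/
theorem norm_perp_selfResidual_le (T A V K : EuclideanSpace ℝ (Fin 3)) (β : ℝ) (hT : ‖T‖ = 1) :
    ‖(A - β • (cross T V + cross K K)) - ⟪A - β • (cross T V + cross K K), T⟫_ℝ • T‖ ≤ ‖A - β • cross T V‖ := by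
  have hKK : cross K K = 0 := by
    rw [← crossCLM_apply]
    ext i
    fin_cases i <;> simp [crossCLM_apply, cross, crossProduct] <;> ring
  rw [hKK, add_zero]
  exact norm_perpTo_le T _ hT

/-! ## §2 The global curvature ceiling of the LIA reference -/

variable {N : ℕ} {Γ Rb ρ θd : ℝ} {p t : Fin N → EuclideanSpace ℝ (Fin 3)} {γ : Fin N → ℝ} {α : ℝ} {s₀ : Fin N → ℝ}
  {x : Fin N → ℝ → EuclideanSpace ℝ (Fin 3)}

/-- **Global curvature ceiling**: `‖x_j″σ‖ ≤ |β⁻¹|(B_d + (½+|α|)√3ℓ)` everywhere (`ℓ = Rb√(Γ log Γ) > 0`, partner distance `d = (ρ/2)√Γ > 0`). [folklore] -/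
theorem IsLiaReference.norm_deriv_deriv_le_ceiling (hx : IsLiaReference Γ Rb p t γ α s₀ x) (ht : ∀ k, ‖t k‖ = 1) (hθd : 0 < θd)
    (hθd1 : θd ≤ 1) (hgp : ∀ j k, j ≠ k → |inner ℝ (t j) (t k)| ≤ 1 - θd) (hρ : 0 < ρ)
    (hsep : ∀ j k, j ≠ k → ∀ a b : ℝ, ρ ≤ ‖(p j + a • t j) - (p k + b • t k)‖) (j : Fin N) {θ₁ : ℝ} (hθ₁0 : 0 ≤ θ₁)
    (hθ₁A : ∀ k, k ≠ j → θ₁ ≤ min (Real.sqrt θd / 4) (θd * ρ / (16 * (‖(p j + s₀ j • t j) - (p k + s₀ k • t k)‖ + ρ))))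
    (htilt : ∀ σ, ‖deriv (x j) σ - t j‖ ≤ θ₁) (hΓ : 0 < Γ) (hℓ : 0 < Rb * Real.sqrt (Γ * Real.log Γ)) (σ : ℝ) :
    ‖deriv (deriv (x j)) σ‖ ≤ |(liaCoeff Γ γ j)⁻¹| *
      ((∑ k ∈ Finset.univ.erase j, |Γ * γ k / (4 * Real.pi)| * (2 / (ρ / 2 * Real.sqrt Γ))) +
        (1 / 2 + |α|) * (Real.sqrt 3 * (Rb * Real.sqrt (Γ * Real.log Γ)))) := by
  obtain ⟨hC2, hunit, -, -, hode⟩ := hx j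
  set ℓ := Rb * Real.sqrt (Γ * Real.log Γ) with hℓdef
  set d := ρ / 2 * Real.sqrt Γ with hd
  have hd0 : 0 < d := by have := Real.sqrt_pos.2 hΓ; positivity
  have hb0 : 0 ≤ |(liaCoeff Γ γ j)⁻¹| := abs_nonneg _
  have hB0 : 0 ≤ (∑ k ∈ Finset.univ.erase j, |Γ * γ k / (4 * Real.pi)| * (2 / d)) :=
    Finset.sum_nonneg fun k _ => by positivity
  -- x″ = iteratedDeriv 2
  have hit : deriv (deriv (x j)) σ = iteratedDeriv 2 (x j) σ := by rw [iteratedDeriv_succ, iteratedDeriv_one]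
  by_cases hfar : 3 * ℓ ^ 2 ≤ ‖x j σ‖ ^ 2
  · -- straight region: x″ = 0
    have h0 : iteratedDeriv 2 (x j) σ = 0 := by rw [hode σ, refCutoff_eq_zero hℓ.ne' hfar, mul_zero, zero_smul]
    rw [hit, h0, norm_zero]; positivity
  · push Not at hfar
    have hxle : ‖x j σ‖ ≤ Real.sqrt 3 * ℓ := by
      have h3 : Real.sqrt 3 * ℓ = Real.sqrt (3 * ℓ ^ 2) := by
        rw [Real.sqrt_mul (by norm_num), Real.sqrt_sq hℓ.le]
      rw [h3]; exact Real.le_sqrt_of_sq_le hfar.le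
    have hfark : ∀ k, k ≠ j → d ^ 2 ≤ ‖x j σ - waistPt Γ p t s₀ k‖ ^ 2 - (inner ℝ (x j σ - waistPt Γ p t s₀ k) (t k)) ^ 2 :=
      hx.dist_partner_ge_of_tilt ht hθd hθd1 hgp hρ hsep j hθ₁0 hθ₁A htilt σ
    have hW := norm_ambientField_le Γ p t γ α s₀ ht j (x j σ) hd0 hfark
    rw [hit]
    calc ‖iteratedDeriv 2 (x j) σ‖ ≤ |(liaCoeff Γ γ j)⁻¹| * ‖ambientField Γ p t γ α s₀ j (x j σ)‖ := hx.norm_iteratedDeriv_two_le j σ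
      _ ≤ |(liaCoeff Γ γ j)⁻¹| * ((∑ k ∈ Finset.univ.erase j, |Γ * γ k / (4 * Real.pi)| * (2 / d)) + (1 / 2 + |α|) * ‖x j σ‖) :=
          mul_le_mul_of_nonneg_left hW hb0
      _ ≤ |(liaCoeff Γ γ j)⁻¹| * ((∑ k ∈ Finset.univ.erase j, |Γ * γ k / (4 * Real.pi)| * (2 / d)) + (1 / 2 + |α|) * (Real.sqrt 3 * ℓ)) := by
          gcongr

end Summit.NavierStokesRegularity.NavierStokesRegularity.Theorems.SkeletonJ1RFrame

end
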